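import Summits.RiemannHypothesis.RiemannHypothesis.Theorems.ZetaStringArchWallDefs
import Summits.RiemannHypothesis.RiemannHypothesis.Theorems.IntegerScrewTopBlockNegHead

/-!
# ZetaStringArchWall — `ArchWallTies (3/4)`: the archimedean wall alone is NOT positive semidefinite by depth `3/4` (kernel certificate; column DBR, RH-FREE)

RH-FREE finite certificate about the explicit prime-free function `Ψ_∅ = archScrew` (no zero of `ζ` enters); nothing here
bears on the truth of RH.  It is the N = 2 "necessity depth" instance of the cell rh-dbr's ET6 (ENGINE-TARGETS.md §3.4,
rh-dbr-theory g7; TARGET-v7 §K.2 typed `ArchWallTies (3/4)`): the Weil–Kreĭn operator of the explicit formula with EVERY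
prime removed stops being positive before the one-sided window reaches `3/4` (data of record: `ℓ*(∅) = 0.74320`, certified
`≤ 0.743227`, rh-dbr-eng-5 ET6/ET6b, 2026-08-26) — "positivity is tight at the prime 2: the wall alone ties 0.05 after log 2".

THE CERTIFICATE.  Nodes `t_i = log((61+i)/60)`, `0 ≤ i < 67` (log-rational, `0 < t_i ≤ log(127/60) = 0.7498 < 3/4`), integer
weights `k_i` (`kList`, the rounded bottom direction of the chord Gram matrix); the real quadratic form
`Q = Σ_i Σ_j k_i k_j [Ψ_∅(t_i) + Ψ_∅(t_j) − Ψ_∅(t_i − t_j)]` is `< 0` (`quadForm_neg`; float value `−3.2·10²·10⁻²…`, i.e.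
`−0.032` for the unit-normalised direction, margin ≈ 60× the enclosure budget).  Every value needed is `Ψ_∅(log(a/b))` with
`1 ≤ b < a ≤ 128`, and `Ψ_∅(log(a/b)) = u(a,b) + C/4 + φ(log(a/b))` with `u(a,b) = Ψ(log(a/b)) − C/4` ENCLOSED BY THE TREE's
kernel-verified table `RungCert.utab127` of the rung certificate `IntegerScrewRung128` (`mem_ug_utab127`), `C = ζ(2,¼)`
two-sidedly bounded (`cLoQ_le_lerchC`, `lerchC_le_cHiQ`), and the prime sum `φ` (here only the `n = 2` hinge, for `a ≥ 2b`)
enclosed by the same certificate's validated von Mangoldt / square-root / logarithm tables (`mem_primeSumEnclW`).  One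
`decide +kernel` evaluates the interval sum (`archCheck_true`).  Method [folklore]: S. M. Rump, Acta Numerica 19 (2010) §10
(verified inclusions); source of `Ψ`: M. Suzuki, J. Lond. Math. Soc. (2) 108 (2023) = arXiv:2206.03682, (1.1) [Suzuki2023].
-/

set_option linter.dupNamespace false
set_option autoImplicit false

namespace Summit.RiemannHypothesis.RiemannHypothesis.Theorems.ZetaStringArchWall

open Literature.NumberTheory.LFunctions Literature.Analysis.ValidatedNumerics
open Literature.Analysis.ValidatedNumerics.Numerics Literature.Analysis.Complex
open Summit.RiemannHypothesis.RiemannHypothesis.Theorems.IntegerScrew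
open Summit.RiemannHypothesis.RiemannHypothesis.Theorems.IntegerScrew.RungCert
open Summit.RiemannHypothesis.RiemannHypothesis.Theorems.IntegerScrew.TopBlockNeg
open scoped ComplexOrder

/-! ## §1 Certificate data -/

/-- The integer weights `k_0, …, k_66` of the negative direction (bottom eigenvector of the 67-node chord Gram matrix of
`Ψ_∅` at nodes `log((61+i)/60)`, scaled by `100` and rounded). [folklore] -/
def kList : List ℤ :=
  [79, 52, 39, 29, 21, 14, 8, 2, -3, -8, -12, -17, -20, -24, -27, -30, -32, -34, -36, -37, -38, -39, -40, -40, -40, -40,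
   -39, -39, -38, -37, -36, -34, -33, -31, -30, -28, -26, -24, -22, -20, -18, -16, -14, -12, -10, -8, -6, -4, -2, 1, 3, 5,
   7, 9, 10, 12, 14, 16, 19, 21, 23, 26, 30, 36, 50, 154, 100]

/-- Weight of node `i` (junk `0` beyond `66`). [folklore] -/
def kf (i : ℕ) : ℤ := kList.getD i 0

/-! ## §2 The real quantities -/

/-- `v(a,b) = Ψ_∅(log(a/b)) − C/4 = u(a,b) + φ(log(a/b))` (`u = uR` of the rung certificate, `φ` the prime sum). [folklore] -/
noncomputable def vR (a b : ℕ) : ℝ := uR a b + zetaScrewPrimeSum (Real.log ((a : ℝ) / b))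

/-- `Ψ_∅(log(a/b)) = v(a,b) + C/4`. [folklore] -/
theorem archScrew_log_div_eq (a b : ℕ) : archScrew (Real.log ((a : ℝ) / b)) = vR a b + lerchC / 4 := by
  unfold archScrew vR uR; ring

/-- The nodes `t_i = log((61 + i)/60)`. [folklore] -/
noncomputable def node (i : ℕ) : ℝ := Real.log (((61 + i : ℕ) : ℝ) / ((60 : ℕ) : ℝ))

/-- The kernel entry `Ψ_∅(t_i) + Ψ_∅(t_j) − Ψ_∅(t_i − t_j)` (real). [folklore] -/
noncomputable def archKR (i j : ℕ) : ℝ := archScrew (node i) + archScrew (node j) - archScrew (node i - node j)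

/-- The off-diagonal value `Ψ_∅(t_i − t_j) = v(61 + max, 61 + min) + C/4` (`0` on the diagonal). [folklore] -/
noncomputable def wR (i j : ℕ) : ℝ := if i = j then 0 else vR (61 + max i j) (61 + min i j) + lerchC / 4

/-- `Ψ_∅(t_i) = v(61+i, 60) + C/4`. [folklore] -/
theorem archScrew_node (i : ℕ) : archScrew (node i) = vR (61 + i) 60 + lerchC / 4 :=
  archScrew_log_div_eq _ _

/-- `t_i − t_j = log((61+i)/(61+j))`. [folklore] -/
theorem node_sub (i j : ℕ) : node i - node j = Real.log (((61 + i : ℕ) : ℝ) / ((61 + j : ℕ) : ℝ)) := by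
  unfold node
  have hi : (0 : ℝ) < ((61 + i : ℕ) : ℝ) := by positivity
  have hj : (0 : ℝ) < ((61 + j : ℕ) : ℝ) := by positivity
  have h60 : (0 : ℝ) < ((60 : ℕ) : ℝ) := by positivity
  rw [Real.log_div hi.ne' h60.ne', Real.log_div hj.ne' h60.ne', Real.log_div hi.ne' hj.ne']
  ring

/-- `Ψ_∅(t_i − t_j) = wR i j` (evenness of `Ψ_∅` for `i < j`, `Ψ_∅(0) = 0` for `i = j`). [folklore] -/
theorem archScrew_node_sub (i j : ℕ) : archScrew (node i - node j) = wR i j := by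
  unfold wR
  split_ifs with h
  · subst h; simp
  · rcases Nat.lt_or_gt_of_ne h with hlt | hgt
    · rw [max_eq_right hlt.le, min_eq_left hlt.le, ← archScrew_neg, neg_sub, node_sub, archScrew_log_div_eq]
    · rw [max_eq_left hgt.le, min_eq_right hgt.le, node_sub, archScrew_log_div_eq]

/-- Entry formula: `archKR i j = (v(61+i,60) + C/4) + (v(61+j,60) + C/4) − wR i j`. [folklore] -/
theorem archKR_eq (i j : ℕ) : archKR i j = (vR (61 + i) 60 + lerchC / 4) + (vR (61 + j) 60 + lerchC / 4) - wR i j := by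
  rw [archKR, archScrew_node, archScrew_node, archScrew_node_sub]

/-! ## §3 Enclosures (computable) -/

/-- Enclosure of `log a − log b` from the certificate's logarithm table. [folklore] -/
def tEn (a b : ℕ) : FI := (lg logs127 a).sub (lg logs127 b)

/-- Enclosure of `v(a,b)`: table entry `u(a,b)` plus the prime-sum enclosure at `t = log(a/b)` (`⌊e^t⌋ = a / b`). [folklore] -/
def vEncl (a b : ℕ) : FI := (ug utab127 a b).add (primeSumEnclW lam127 sqs127 logs127 (tEn a b) (a / b))

/-- Two-sided enclosure of `C/4`, `C = ζ(2,¼)` (`cLoQ ≤ C ≤ cHiQ`). [folklore] -/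
def cEncl : FI := FI.ofRatRat (cLoQ / 4) (cHiQ / 4)

/-- Enclosure of the kernel entry `archKR i j`. [folklore] -/
def kerEncl (c : FI) (i j : ℕ) : FI :=
  (((vEncl (61 + i) 60).add c).add ((vEncl (61 + j) 60).add c)).sub
    (if i = j then FI.ofInt 0 else (vEncl (61 + max i j) (61 + min i j)).add c)

/-- Enclosure of the weighted row sum `Σ_{j<n} archKR i j · k_i k_j`. [folklore] -/
def rowEncl (c : FI) (i : ℕ) : ℕ → FI
  | 0 => FI.ofInt 0
  | j + 1 => (rowEncl c i j).add ((kerEncl c i j).mulInt (kf i * kf j))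

/-- Enclosure of `Σ_{i<n} Σ_{j<67} archKR i j · k_i k_j`. [folklore] -/
def qEncl (c : FI) : ℕ → FI
  | 0 => FI.ofInt 0
  | i + 1 => (qEncl c i).add (rowEncl c i 67)

/-- THE TEST: the upper end of the enclosure of `Q` is negative. [folklore] -/
def archCheck (c : FI) : Bool := decide ((qEncl c 67).hi < 0)

/-! ## §4 Soundness of the enclosures -/

/-- The validated tables of `IntegerScrewRung128`: von Mangoldt values, square roots and logarithms to `128`. [folklore] -/
theorem tables127 :
    (∀ n : ℕ, n ≤ 128 → (ArithmeticFunction.vonMangoldt n : ℝ) = Real.log (lamG lam127 n) ∧ lamG lam127 n ≤ max n 1) ∧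
    (∀ n : ℕ, n ≤ 128 → FI.mem (Real.sqrt (n : ℝ)) (lg sqs127 n)) ∧
    (∀ n : ℕ, n ≤ 128 → FI.mem (Real.log (n : ℝ)) (lg logs127 n)) := by
  have h := light127
  unfold rungLightW at h
  simp only [Bool.and_eq_true, decide_eq_true_eq] at h
  obtain ⟨⟨⟨⟨⟨hlam, hsq⟩, hlogs⟩, hok⟩, _⟩, _⟩ := h
  exact ⟨fun n hn => lamTabOK_sound hlam (n := n) hn, fun n hn => mem_of_sqrtTabOK hsq (n := n) hn,
    logsOK_of_eq hlogs hok⟩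

/-- `v(a,b) ∈ vEncl a b` for `1 ≤ b < a ≤ 128`. [folklore] -/
theorem mem_vEncl {a b : ℕ} (hb : 0 < b) (hba : b < a) (ha : a ≤ 128) : FI.mem (vR a b) (vEncl a b) := by
  obtain ⟨hΛ, hS, hL⟩ := tables127
  have hu := mem_ug_utab127 a b hb hba ha
  have ha0 : 0 < a := hb.trans hba
  have ha' : (0 : ℝ) < a := by exact_mod_cast ha0
  have hb' : (0 : ℝ) < b := by exact_mod_cast hb
  have hlog : Real.log ((a : ℝ) / b) = Real.log a - Real.log b := Real.log_div ha'.ne' hb'.ne'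
  have htpos : 0 < Real.log a - Real.log b := by
    rw [← hlog]; exact Real.log_pos ((one_lt_div hb').2 (by exact_mod_cast hba))
  have hexp : Real.exp (Real.log a - Real.log b) = (a : ℝ) / b := by
    rw [Real.exp_sub, Real.exp_log ha', Real.exp_log hb']
  have hfloor : ⌊Real.exp (Real.log a - Real.log b)⌋₊ = a / b := by
    rw [hexp]; exact Nat.floor_div_eq_div a b
  have hprime : zetaScrewPrimeSum (Real.log ((a : ℝ) / b)) = ∑ n ∈ Finset.Icc 1 (a / b),
      (ArithmeticFunction.vonMangoldt n : ℝ) / Real.sqrt n * ((Real.log a - Real.log b) - Real.log n) := by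
    unfold zetaScrewPrimeSum; rw [hlog, abs_of_pos htpos, hfloor]
  have hT : FI.mem (Real.log a - Real.log b) (tEn a b) := FI.mem_sub (hL a ha) (hL b (by omega))
  have hP := mem_primeSumEnclW hΛ hS hL hT (m := a / b) ((Nat.div_le_self a b).trans ha)
  unfold vR vEncl
  rw [hprime]
  exact FI.mem_add hu hP

/-- `C/4 ∈ cEncl`. [folklore] -/
theorem mem_cEncl : FI.mem (lerchC / 4) cEncl := by
  unfold cEncl
  refine FI.mem_ofRatRat ?_ ?_
  · have := cLoQ_le_lerchC; rw [← lerchC] at this; push_cast; linarith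
  · have := lerchC_le_cHiQ; push_cast; linarith

/-- `archKR i j ∈ kerEncl cEncl i j` for `i, j < 67`. [folklore] -/
theorem mem_kerEncl {i j : ℕ} (hi : i < 67) (hj : j < 67) : FI.mem (archKR i j) (kerEncl cEncl i j) := by
  rw [archKR_eq]
  have hvi := mem_vEncl (a := 61 + i) (b := 60) (by norm_num) (by omega) (by omega)
  have hvj := mem_vEncl (a := 61 + j) (b := 60) (by norm_num) (by omega) (by omega)
  have hw : FI.mem (wR i j) (if i = j then FI.ofInt 0 else (vEncl (61 + max i j) (61 + min i j)).add cEncl) := by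
    unfold wR
    split_ifs with h
    · simpa using FI.mem_ofInt 0
    · have hne : min i j < max i j := min_lt_max.2 h
      exact FI.mem_add (mem_vEncl (by omega) (by omega) (by omega)) mem_cEncl
  unfold kerEncl
  exact FI.mem_sub (FI.mem_add (FI.mem_add hvi mem_cEncl) (FI.mem_add hvj mem_cEncl)) hw

/-- Row enclosure. [folklore] -/
theorem mem_rowEncl {i : ℕ} (hi : i < 67) : ∀ n : ℕ, n ≤ 67 →
    FI.mem (∑ j ∈ Finset.range n, archKR i j * ((kf i * kf j : ℤ) : ℝ)) (rowEncl cEncl i n)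
  | 0, _ => by simpa [rowEncl] using FI.mem_ofInt 0
  | n + 1, hn => by
      rw [Finset.sum_range_succ]
      exact FI.mem_add (mem_rowEncl hi n (by omega)) (FI.mem_mulInt (mem_kerEncl hi (by omega)) _)

/-- Full enclosure. [folklore] -/
theorem mem_qEncl : ∀ n : ℕ, n ≤ 67 →
    FI.mem (∑ i ∈ Finset.range n, ∑ j ∈ Finset.range 67, archKR i j * ((kf i * kf j : ℤ) : ℝ)) (qEncl cEncl n)
  | 0, _ => by simpa [qEncl] using FI.mem_ofInt 0
  | n + 1, hn => by
      rw [Finset.sum_range_succ]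
      exact FI.mem_add (mem_qEncl n (by omega)) (mem_rowEncl (by omega) 67 le_rfl)

/-! ## §5 The kernel computation -/

set_option maxRecDepth 200000 in
set_option maxHeartbeats 0 in
/-- KERNEL: the interval evaluation of `Q` has negative upper end. [folklore] -/
theorem archCheck_true : archCheck cEncl = true := by
  decide +kernel

/-- **`Q < 0`**: the quadratic form of the wall kernel at the 67 log-rational nodes with the integer weights `kList` is
negative. [folklore] -/
theorem quadForm_neg :
    ∑ i ∈ Finset.range 67, ∑ j ∈ Finset.range 67, archKR i j * ((kf i * kf j : ℤ) : ℝ) < 0 := by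
  have hc := archCheck_true
  unfold archCheck at hc
  rw [decide_eq_true_eq] at hc
  have hmem := (mem_qEncl 67 le_rfl).2
  have hS := SC_pos
  generalize hZ : (qEncl cEncl 67).hi = Z at hc hmem
  have h2 : ((Z : ℤ) : ℝ) < ((0 : ℤ) : ℝ) := Int.cast_lt.2 hc
  rw [Int.cast_zero] at h2
  generalize hQ : (∑ i ∈ Finset.range 67, ∑ j ∈ Finset.range 67, archKR i j * ((kf i * kf j : ℤ) : ℝ)) = Q at hmem ⊢
  by_contra hneg
  have hQ0 : 0 ≤ Q := not_lt.1 hneg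
  have hprod : 0 ≤ Q * (SC : ℝ) := mul_nonneg hQ0 hS.le
  linarith

/-! ## §6 The nodes lie in `(0, 3/4)` -/

/-- `0 < t_i`. [folklore] -/
theorem node_pos (i : ℕ) : 0 < node i := by
  unfold node
  refine Real.log_pos ((one_lt_div (by positivity)).2 ?_)
  have : (61 : ℝ) ≤ ((61 + i : ℕ) : ℝ) := by exact_mod_cast (Nat.le_add_right 61 i)
  push_cast at this ⊢
  linarith

/-- `127/60 < e^{3/4}` (six Taylor terms: `Σ_{n<6} (3/4)ⁿ/n! = 2.11671… > 2.11666…`). [folklore] -/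
theorem div_lt_exp_three_quarters : (127 : ℝ) / 60 < Real.exp (3 / 4) := by
  have h := Real.sum_le_exp_of_nonneg (x := (3 / 4 : ℝ)) (by norm_num) 6
  simp only [Finset.sum_range_succ, Finset.sum_range_zero, Nat.factorial] at h
  norm_num at h
  linarith

/-- `t_i < 3/4` for `i < 67` (i.e. `(61+i)/60 ≤ 127/60 < e^{3/4}`). [folklore] -/
theorem node_lt {i : ℕ} (hi : i < 67) : node i < 3 / 4 := by
  unfold node
  have hpos : (0 : ℝ) < ((61 + i : ℕ) : ℝ) / ((60 : ℕ) : ℝ) := by positivity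
  rw [Real.log_lt_iff_lt_exp hpos]
  refine lt_of_le_of_lt ?_ div_lt_exp_three_quarters
  have : ((61 + i : ℕ) : ℝ) ≤ 127 := by exact_mod_cast (show 61 + i ≤ 127 by omega)
  push_cast at this ⊢
  exact div_le_div_of_nonneg_right this (by norm_num)

/-! ## §7 The theorem -/

/-- **`ArchWallTies (3/4)`** (RH-FREE kernel certificate): the archimedean-wall kernel `Ψ_∅(t) + Ψ_∅(u) − Ψ_∅(t − u)` is
NOT positive semidefinite on configurations in `(0, 3/4)` — witnessed by the 67 nodes `log((61+i)/60)` and the integer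
weights `kList`.  The N = 2 necessity-depth instance of ET6: the explicit formula with all primes removed is not positive
by one-sided depth `3/4` (`> log 2`); with the prime `2` restored it is (`weilPositivityOn` rungs to `(log 3)/2`).
Nothing here bears on the truth of RH. [folklore] -/
theorem archWallTies_three_quarters : ArchWallTies (3 / 4) := by
  intro hpsd
  have h := hpsd 67 (fun i => node i) (fun i => ⟨node_pos i, node_lt i.isLt⟩) (fun i => ((kf i : ℝ) : ℂ))
  have hterm : ∀ i j : Fin 67, (starRingEnd ℂ) ((kf i : ℝ) : ℂ) * ((kf j : ℝ) : ℂ) * archKernel (node i) (node j)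
      = ((archKR i j * ((kf i * kf j : ℤ) : ℝ) : ℝ) : ℂ) := by
    intro i j
    rw [Complex.conj_ofReal, archKernel, archKR]
    push_cast
    ring
  simp only [hterm, ← Complex.ofReal_sum] at h
  have hQ := quadForm_neg
  rw [Finset.sum_range] at hQ
  simp_rw [Finset.sum_range] at hQ
  exact absurd (Complex.zero_le_real.1 h) (not_le.2 hQ)

/-- The bracket's negative half, recorded under the typed name: `ArchWallTies (3/4)` holds; hence also for every
`ℓ̄ ≥ 3/4`. [folklore] -/
theorem archWallTies_of_ge {l : ℝ} (hl : 3 / 4 ≤ l) : ArchWallTies l :=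
  archWallTies_three_quarters.mono hl

end Summit.RiemannHypothesis.RiemannHypothesis.Theorems.ZetaStringArchWall
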